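import Summits.ResolutionOfSingularities.ResolutionOfSingularities.Theorems.PAlterationPicoverLocalModelWoundExit
import Summits.ResolutionOfSingularities.ResolutionOfSingularities.Theorems.PAlterationPicoverLocalModelTransversalExit
import Literature.AlgebraicGeometry.Resolution.RegularLocalRingsNormal

/-!
# Route `RadicialJung`, support `CleanResolves`: the normalisation over a regular-type point

Route `ResolutionOfSingularities/RadicialJung`, support item `CleanResolves`
(stmt-ResolutionOfSingularities-16286): at a point `v` of the clean model `V` of REGULAR TYPE — the
chosen generator `y` of the purely inseparable degree-`p` extension `L/K(V)` has `y^p = u₀`, a unit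
of `O = 𝒪_{V,v}` which is either residually not a `p`-th power (`∀ c, u₀ - c^p ∉ 𝔪`, WOUND) or
congruent to a `p`-th power up to a regular parameter (`u₀ - c^p ∈ 𝔪 ∖ 𝔪²`, TRANSVERSAL) — the plan
says "V^L is regular". This file proves the local algebra behind it, for an abstract regular local
ring `O` of characteristic `p` with fraction field `K` and a field extension `L/K` of degree `p`
generated by a `p`-th root `y ∉ K` of `u ∈ O`:

* `isIntegralClosure_adjoinRoot_of_isRegularLocalRing` — if the order `A = O[T]/(T^p - u)` is a
  regular local ring then `A`, mapped to `L` by `T ↦ y`, IS the integral closure of `O` in `L`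
  (`A` is an integrally closed domain, Matsumura 14.3/19.4 in tree; `A → L` is injective by
  incomparability; `Frac A = L` because `L = K(y)` by the degree count);
* `isRegularLocalRing_integralClosure_of_isRegularLocalRing` — hence `integralClosure O L` is a
  regular local ring;
* `isRegularLocalRing_integralClosure_of_wound` / `_of_transversal` — the two regular-type cases,
  from the proved ring-level exits `PicoverLocalModel.WoundExit.isRegularLocalRing_adjoinRoot_of_wound`
  and `PicoverLocalModel.TransversalExit.isRegularLocalRing_adjoinRoot_of_transversal` (route
  `pAlteration`).

What is NOT here: the scheme-level identification of the stalks of `normalizationIn V L` over `v`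
with (localisations of) `integralClosure 𝒪_{V,v} L`.
-/

noncomputable section

set_option linter.dupNamespace false -- mandated namespace of this single-conjunct summit

open Polynomial
open Literature.AlgebraicGeometry.Resolution
open Summit.ResolutionOfSingularities.ResolutionOfSingularities.Theorems.PicoverLocalModel

namespace Summit.ResolutionOfSingularities.ResolutionOfSingularities.Theorems.RadicialJung.CleanResolves

universe u v w

variable {O : Type u} [CommRing O] {K : Type v} [Field K] [Algebra O K] [IsFractionRing O K]
  {L : Type w} [Field L] [Algebra K L] [Algebra O L] [IsScalarTower O K L]
  [FiniteDimensional K L] {p : ℕ}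

/-- **`L = K(y)` in coordinates.** If `[L : K] = p` is prime and `y ∈ L ∖ K` has `y^p = u ∈ O`
(`K = Frac O`, characteristic `p`), then every `z ∈ L` is `q(y)/b` for a polynomial `q ∈ O[T]`
and a non-zero `b ∈ O`: the minimal polynomial of `y` is `T^p - u` (irreducible as `u` is not a
`p`-th power in `K`, Frobenius being injective on `L`), so `K(y) = L` by degrees, and denominators
are cleared by `IsLocalization.integerNormalization`. [folklore] -/
theorem exists_aeval_div_eq [CharP L p] (hp : p.Prime) (hdeg : Module.finrank K L = p) (u : O)
    (y : L) (hy : y ∉ Set.range (algebraMap K L)) (hyp : y ^ p = algebraMap O L u) (z : L) :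
    ∃ (q : O[X]) (b : O), algebraMap O L b ≠ 0 ∧ z = aeval y q / algebraMap O L b := by
  haveI : Fact p.Prime := ⟨hp⟩
  haveI : Nontrivial O := ⟨⟨0, 1, fun h => (zero_ne_one : (0 : K) ≠ 1) (by simpa using congrArg (algebraMap O K) h)⟩⟩
  -- the minimal polynomial of `y` over `K` is `T^p - u`
  have hirr : Irreducible ((X : K[X]) ^ p - C (algebraMap O K u)) := by
    refine X_pow_sub_C_irreducible_of_prime hp fun b hb => hy ⟨b, ?_⟩
    have h1 : (algebraMap K L b) ^ p = y ^ p := by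
      rw [← map_pow, hb, hyp, ← IsScalarTower.algebraMap_apply]
    exact frobenius_inj L p h1
  have hroot : aeval y ((X : K[X]) ^ p - C (algebraMap O K u)) = 0 := by
    simp only [map_sub, map_pow, aeval_X, aeval_C, ← IsScalarTower.algebraMap_apply, hyp, sub_self]
  have hmin : minpoly K y = (X : K[X]) ^ p - C (algebraMap O K u) :=
    (minpoly.eq_of_irreducible_of_monic hirr hroot (monic_X_pow_sub_C _ hp.ne_zero)).symm
  have hyint : IsIntegral K y := IsIntegral.of_finite K y
  -- hence `K(y) = L`
  have htop : IntermediateField.adjoin K {y} = ⊤ := by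
    rw [Field.primitive_element_iff_minpoly_natDegree_eq, hmin, natDegree_X_pow_sub_C, hdeg]
  have hz : z ∈ (aeval y : K[X] →ₐ[K] L).range := by
    rw [← Algebra.adjoin_singleton_eq_range_aeval,
      ← IntermediateField.adjoin_simple_toSubalgebra_of_isAlgebraic hyint.isAlgebraic, htop]
    trivial
  rw [AlgHom.mem_range] at hz
  obtain ⟨q, hq⟩ := hz
  -- clear denominators
  obtain ⟨b, hb, hbq⟩ := IsLocalization.integerNormalization_spec (nonZeroDivisors O) q
  have hb0 : algebraMap O L b ≠ 0 := by
    rw [IsScalarTower.algebraMap_apply O K L, _root_.map_ne_zero]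
    exact IsFractionRing.to_map_ne_zero_of_mem_nonZeroDivisors hb
  refine ⟨IsLocalization.integerNormalization (nonZeroDivisors O) q, b, hb0, ?_⟩
  have key : aeval y (IsLocalization.integerNormalization (nonZeroDivisors O) q) =
      algebraMap O L b * aeval y q := by
    rw [← aeval_map_algebraMap K, hbq, ← algebraMap_smul K b q, map_smul, Algebra.smul_def,
      ← IsScalarTower.algebraMap_apply]
  rw [key, mul_div_cancel_left₀ _ hb0, hq]

/-- **A regular order `O[T]/(T^p - u)` is the integral closure.** Let `O` be a regular local ring
of characteristic `p` with fraction field `K`, `L/K` of degree `p`, `y ∈ L ∖ K` with `y^p = u ∈ O`,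
and suppose `A = O[T]/(T^p - u)` is a regular local ring. Then `A → L`, `T ↦ y`, is injective and
exhibits `A` as the integral closure of `O` in `L`: `A` is a domain (Matsumura 14.3) finite over `O`,
so its kernel, lying over `(0)`, is `(0)` (incomparability); every `z ∈ L` is `a/b` with `a ∈ A`,
`b ∈ O ∖ 0` (`exists_aeval_div_eq`), so `L = Frac A`; and `A` is integrally closed (Matsumura 19.4),
hence integrally closes `O` in `L`. [folklore] -/
theorem isIntegralClosure_adjoinRoot_of_isRegularLocalRing [CharP L p] (hp : p.Prime)
    (hdeg : Module.finrank K L = p) (u : O) (y : L) (hy : y ∉ Set.range (algebraMap K L))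
    (hyp : y ^ p = algebraMap O L u)
    [hA : IsRegularLocalRing (AdjoinRoot ((X : O[X]) ^ p - C u))] :
    ∃ φ : AdjoinRoot ((X : O[X]) ^ p - C u) →ₐ[O] L, φ (AdjoinRoot.root _) = y ∧
      Function.Injective φ ∧
      @IsIntegralClosure (AdjoinRoot ((X : O[X]) ^ p - C u)) O L _ _ _ _ φ.toRingHom.toAlgebra := by
  haveI : Fact p.Prime := ⟨hp⟩
  set f : O[X] := (X : O[X]) ^ p - C u with hf_def
  have hf : f.Monic := monic_X_pow_sub_C u hp.ne_zero
  haveI : IsDomain (AdjoinRoot f) := isDomain_of_isRegularLocalRing (AdjoinRoot f)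
  haveI : IsIntegrallyClosed (AdjoinRoot f) := isIntegrallyClosed_of_isRegularLocalRing (AdjoinRoot f)
  haveI : Module.Finite O (AdjoinRoot f) := hf.finite_adjoinRoot
  haveI : Algebra.IsIntegral O (AdjoinRoot f) := inferInstance
  -- `O` is a domain (it embeds in `K`) and nontrivial
  have hOK : Function.Injective (algebraMap O K) := IsFractionRing.injective O K
  haveI : Nontrivial O :=
    ⟨⟨0, 1, fun h => (zero_ne_one : (0 : K) ≠ 1) (by simpa using congrArg (algebraMap O K) h)⟩⟩
  have hOL : Function.Injective (algebraMap O L) := by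
    rw [IsScalarTower.algebraMap_eq O K L]
    exact (algebraMap K L).injective.comp hOK
  -- the map `T ↦ y`
  have hroot : f.eval₂ (↑(Algebra.ofId O L)) y = 0 := by
    change aeval y f = 0
    simp only [hf_def, map_sub, map_pow, aeval_X, aeval_C, hyp, sub_self]
  let φ : AdjoinRoot f →ₐ[O] L := AdjoinRoot.liftAlgHom f (Algebra.ofId O L) y hroot
  have hφroot : φ (AdjoinRoot.root f) = y := AdjoinRoot.liftAlgHom_root f _ y hroot
  -- injectivity by incomparability
  have hφinj : Function.Injective φ := by
    rw [injective_iff_map_eq_zero]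
    intro a ha
    have hker : RingHom.ker φ.toRingHom = ⊥ := by
      haveI : (RingHom.ker φ.toRingHom).IsPrime := RingHom.ker_isPrime _
      refine Ideal.eq_bot_of_comap_eq_bot (R := O) ?_
      refine eq_bot_iff.mpr fun x hx => ?_
      rw [Ideal.mem_comap, RingHom.mem_ker] at hx
      change φ (algebraMap O (AdjoinRoot f) x) = 0 at hx
      rw [φ.commutes] at hx
      exact (map_eq_zero_iff _ hOL).mp hx
    have : a ∈ RingHom.ker φ.toRingHom := ha
    rw [hker] at this
    exact this
  refine ⟨φ, hφroot, hφinj, ?_⟩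
  -- `L` is the fraction field of `A` (through `φ`)
  letI algAL : Algebra (AdjoinRoot f) L := φ.toRingHom.toAlgebra
  haveI : IsScalarTower O (AdjoinRoot f) L :=
    IsScalarTower.of_algebraMap_eq fun x => (φ.commutes x).symm
  haveI : FaithfulSMul (AdjoinRoot f) L := (faithfulSMul_iff_algebraMap_injective _ L).mpr hφinj
  haveI : IsFractionRing (AdjoinRoot f) L := by
    refine IsFractionRing.of_field (AdjoinRoot f) L fun z => ?_
    obtain ⟨q, b, -, hz⟩ := exists_aeval_div_eq hp hdeg u y hy hyp z
    refine ⟨AdjoinRoot.mk f q, AdjoinRoot.of f b, ?_⟩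
    have h1 : algebraMap (AdjoinRoot f) L (AdjoinRoot.mk f q) = aeval y q := by
      change φ (AdjoinRoot.mk f q) = aeval y q
      rw [AdjoinRoot.liftAlgHom_mk]
      rfl
    have h2 : algebraMap (AdjoinRoot f) L (AdjoinRoot.of f b) = algebraMap O L b := by
      change φ (AdjoinRoot.of f b) = algebraMap O L b
      rw [← AdjoinRoot.algebraMap_eq]
      exact φ.commutes b
    rw [h1, h2, hz]
  exact IsIntegralClosure.of_isIntegrallyClosed (AdjoinRoot f) O L

/-- **The integral closure over a regular-type point is regular.** With `O, K, L, u, y` as in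
`isIntegralClosure_adjoinRoot_of_isRegularLocalRing`: if the order `O[T]/(T^p - u)` is a regular local
ring, so is `integralClosure O L` (they are isomorphic `O`-algebras, `IsIntegralClosure.equiv`).
[folklore] -/
theorem isRegularLocalRing_integralClosure_of_isRegularLocalRing [CharP L p] (hp : p.Prime)
    (hdeg : Module.finrank K L = p) (u : O) (y : L) (hy : y ∉ Set.range (algebraMap K L))
    (hyp : y ^ p = algebraMap O L u)
    [hA : IsRegularLocalRing (AdjoinRoot ((X : O[X]) ^ p - C u))] :
    IsRegularLocalRing (integralClosure O L) := by
  obtain ⟨φ, -, -, hIC⟩ := isIntegralClosure_adjoinRoot_of_isRegularLocalRing hp hdeg u y hy hyp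
  letI algAL : Algebra (AdjoinRoot ((X : O[X]) ^ p - C u)) L := φ.toRingHom.toAlgebra
  haveI : IsScalarTower O (AdjoinRoot ((X : O[X]) ^ p - C u)) L :=
    IsScalarTower.of_algebraMap_eq fun x => (φ.commutes x).symm
  haveI := hIC
  exact IsRegularLocalRing.of_ringEquiv
    (IsIntegralClosure.equiv O (AdjoinRoot ((X : O[X]) ^ p - C u)) L (integralClosure O L)).toRingEquiv

/-- **Wound regular-type points: the normalised cover is regular.** Let `O` be a regular local
ring of characteristic `p` with fraction field `K`, `L/K` a field extension of degree `p`, and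
`y ∈ L ∖ K` with `y^p = u ∈ O` such that `u - c^p ∉ 𝔪_O` for every `c ∈ O` (the residue of `u` is
not a `p`-th power). Then the integral closure of `O` in `L` is a regular local ring — it is the
order `O[T]/(T^p - u)`, regular by `WoundExit.isRegularLocalRing_adjoinRoot_of_wound`. [folklore] -/
theorem isRegularLocalRing_integralClosure_of_wound [IsRegularLocalRing O] [CharP O p] [CharP L p]
    (hp : p.Prime) (hdeg : Module.finrank K L = p) (u : O) (y : L)
    (hy : y ∉ Set.range (algebraMap K L)) (hyp : y ^ p = algebraMap O L u)
    (hu : ∀ c : O, u - c ^ p ∉ IsLocalRing.maximalIdeal O) :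
    IsRegularLocalRing (integralClosure O L) :=
  haveI := WoundExit.isRegularLocalRing_adjoinRoot_of_wound p hp u hu
  isRegularLocalRing_integralClosure_of_isRegularLocalRing hp hdeg u y hy hyp

/-- **Transversal regular-type points: the normalised cover is regular.** As
`isRegularLocalRing_integralClosure_of_wound`, but with `u - c^p ∈ 𝔪_O ∖ 𝔪_O²` for some `c ∈ O`
(`u` differs from a `p`-th power by a regular parameter); the order `O[T]/(T^p - u)` is regular by
`TransversalExit.isRegularLocalRing_adjoinRoot_of_transversal`. [folklore] -/
theorem isRegularLocalRing_integralClosure_of_transversal [IsRegularLocalRing O] [CharP O p]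
    [CharP L p] (hp : p.Prime) (hdeg : Module.finrank K L = p) (u : O) (y : L)
    (hy : y ∉ Set.range (algebraMap K L)) (hyp : y ^ p = algebraMap O L u) (c : O)
    (hc : u - c ^ p ∈ IsLocalRing.maximalIdeal O) (hc2 : u - c ^ p ∉ IsLocalRing.maximalIdeal O ^ 2) :
    IsRegularLocalRing (integralClosure O L) :=
  haveI : Fact p.Prime := ⟨hp⟩
  haveI := TransversalExit.isRegularLocalRing_adjoinRoot_of_transversal p u c hc hc2
  isRegularLocalRing_integralClosure_of_isRegularLocalRing hp hdeg u y hy hyp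

end Summit.ResolutionOfSingularities.ResolutionOfSingularities.Theorems.RadicialJung.CleanResolves

end
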